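import Summits.HodgeConjecture.HodgeConjecture.Theses.MirrorBraneLift

/-!
# Birth skeleton (BC3) — crux `MirrorRealization` of route `MirrorBraneLift`

Crux item `stmt-HodgeConjecture-18678`, decl
`Summit.HodgeConjecture.HodgeConjecture.Theses.MirrorBraneLift.MirrorRealization`
(`TropicalWeilSupply → LagrangianLift → OneAlgebraicWeilClass`): tropical Weil supply (T) and graded
geometric Lagrangian lifting (A) imply X = one non-zero algebraic Weil class on every abelian
`2m`-fold `(A, φ)`, `φ ≫ φ = -d`, of hyperbolic (split) Weil type, `m ≥ 2`, `d ≥ 1`.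

## The seam (the route header's TWO-LAYER PLAN `MR ⇐ lowRungs → highRungs → MR`, typed and sharpened)

The mechanism of MR (bounding cochain U, family-Floer functor F, spreading S1) has no Lean
vocabulary; what IS typable, and what this skeleton fixes, is its SHAPE:

* **Locality (the pointwise bridge).** The family-Floer mirror functor works ONE tropical torus at a
  time: the mirror of the flat symplectic torus `𝕏(B_Q)`, `Q ∈ 𝓛_d⁺` very general, is ONE abelian
  variety `A_H` over the Novikov field whose complex incarnations are the very general hyperbolic
  Weil-type `(A, φ)` of type `(m, d)`, and spreading (S1) carries the class to every member. So the
  honest typed content of MR at level `(m, d)` is the BRIDGE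
  `Bridge(m, d)`: for every very general `P ∈ 𝓛_d⁺` (`WeilFamily.Polarization m d`,
  `IsVeryGeneral`) and every effective tropical `m`-cycle `Z` on `B_{P.Q}` with non-zero
  `ℚ(√-d)`-Weil functional which admits graded geometric Lagrangian lifts at every scale `ε > 0`,
  EVERY hyperbolic Weil-type `(A, φ)` of type `(m, d)` carries a non-zero algebraic class in its Weil
  plane `weilClassesOf A φ m d`. This is strictly sharper than the `(m, d)`-slice of MR (whose
  hypotheses T and A are GLOBAL — all dimensions, all fields): the bridge must work from the single
  mirror family it is handed, which is what U + F + S1 actually do.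
* **The dimension ladder** (header: "lowRungs (m ≤ 3: the calibration range, m = 2 a theorem, m = 3
  partially) → highRungs (m ≥ 4, the open range; BC5 first rung = m = 4, d = 1)"):
  - `stub_lowRungs` — `Bridge(m, d)` for `2 ≤ m ≤ 3` (CALIBRATION: the conclusion is known in print
    without any mirror — fourfolds of Weil type for every `K` and every discriminant, Markman 2025
    Cor. 1.6.1 = the tree's named fact `Markman2025_weilClasses_algebraic_abelianFourfold` (earlier
    Schoen 1988 / van Geemen 1994 Thm. 6.12 for special `K`); hyperbolic = discriminant `-1`
    sixfolds, Markman 2025 Thm. 1.5.1 = the tree's named fact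
    `Markman2025_weilClasses_algebraic_hyperbolicSixfold` — so this rung tests that the brane
    mechanism re-proves van Geemen/Schoen/Markman, and is closable from print + "the Weil plane of a
    Weil-type `(A, φ)` contains a non-zero rational Hodge class");
  - `stub_firstOpenRung` — `Bridge(4, 1)`: Gaussian hyperbolic abelian eightfolds, the FIRST OPEN
    RUNG ("dim ≥ 8: nothing for any K", Markman 2025 §1.2), typed exactly as the BC5 plan-only target
    named in the route header (`K = ℚ(i)` is where the tropical side is best developed:
    `Tropical/TorusCycles` fixes `δ = 1`, Zharkov's `E_H`, the archive's `dim U_4 = 3`);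
  - `stub_highRungs` — `Bridge(m, d)` for all `m ≥ 4`, `(m, d) ≠ (4, 1)`: the open range proper.
* **Very general members exist** — `stub_veryGeneral_nonempty`: for every `n` and `δ ≥ 1` the
  tropical Weil family `𝓛_δ⁺` has a very general member (`n²` algebraically independent real
  coordinates with `Q = (δQ₀, Q₂; -Q₂, Q₀) ≻ 0`). T quantifies over very general `P` but never
  asserts one exists; without this genuine transcendence lemma (infinite transcendence degree of
  `ℝ/ℚ` + openness of the positive cone; size M) T cannot be invoked at all.

`MirrorRealization_of` is the real (sorry-free) composition: given T, A and `(m, d, A, φ, …)`, pick a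
very general `P : Polarization m d` (stub 1), take `Z` from T and its lifts from A, and apply the rung
owning `m` (`m ≤ 3` / `(m, d) = (4, 1)` / the rest).

No stub alone gives the crux (each rung misses the other dimensions, and none produces a very
general member; stub 1 is a statement about real matrices) nor `HodgeConjecture`; the BC3 probes
(`stub → MirrorRealization`, `stub → HodgeConjecture` by `first | exact? | simpa | aesop`) are run in
the registering seat's probe file `bc/MirrorRealization_probes.lean` and all fail (that seat's
NOTES.md quotes the goals). Disproof used: none (no `Disproof.lean` on this crux). Dead lines: none
on this crux; the tropical precedent `TropicalCuspLift` died at depth-one cusps (stmt-2620, a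
`K`-balance obstruction absent at the totally toric cusp used here) — not a statement of this seam.
-/

set_option linter.dupNamespace false

namespace Summit.HodgeConjecture.HodgeConjecture.Cruxes.MirrorRealization.Birth

open CategoryTheory
open scoped Manifold
open Summit.HodgeConjecture.HodgeConjecture.Theses.MirrorBraneLift
open Literature.AlgebraicGeometry.Tropical
open Literature.AlgebraicGeometry.HodgeTheory
open Literature.AlgebraicGeometry.Motives
open Literature.Geometry.Symplectic

/-- **Stub 1 — very general members of the tropical Weil family exist.** For every `n` and every
`δ ≥ 1` there is a member `P` of `𝓛_δ⁺` (a positive definite `Q = (δQ₀, Q₂; -Q₂, Q₀)`) whose `n²`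
free coordinates are algebraically independent over `ℚ` (`Polarization.IsVeryGeneral`): choose the
coordinates algebraically independent inside the open set where `Q ≻ 0` (it contains
`Q₀ = 1, Q₂ = 0`), using that `ℝ` has infinite transcendence degree over `ℚ`.
[cite: Zharkov2020TropicalWeil, p. 3] [cite: MikhalkinZharkov2014Eigenwave, Def. 6.1] -/
theorem stub_veryGeneral_nonempty :
    ∀ (n δ : ℕ), 1 ≤ δ → ∃ P : WeilFamily.Polarization n δ, P.IsVeryGeneral := by
  sorry

/-- **Stub 2 — the low rungs `2 ≤ m ≤ 3` of the pointwise bridge (calibration range).** For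
`m ∈ {2, 3}`, `d ≥ 1`, a very general `P ∈ 𝓛_d⁺` and an effective tropical `m`-cycle `Z` on `B_{P.Q}`
with non-zero `ℚ(√-d)`-Weil functional admitting graded geometric Lagrangian lifts at every scale:
every hyperbolic Weil-type abelian `2m`-fold `(A, φ)`, `φ ≫ φ = -d`, carries a non-zero algebraic
class in `weilClassesOf A φ m d`. The conclusion is known in print (fourfolds: every `K`, every
discriminant — Markman 2025 Cor. 1.6.1, tree fact `Markman2025_weilClasses_algebraic_abelianFourfold`;
sixfolds: discriminant `-1` = hyperbolic — Markman 2025 Thm. 1.5.1, tree fact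
`Markman2025_weilClasses_algebraic_hyperbolicSixfold`), so this rung calibrates the brane mechanism
(bounding cochain + family Floer + spreading) against van Geemen/Schoen/Markman, and is closable
from those facts plus "the Weil plane of a Weil-type `(A, φ)` contains a non-zero rational Hodge
class" without any mirror.
[cite: Markman2025SecantWeil, Thm. 1.5.1, Cor. 1.6.1 and §1.2] [cite: vanGeemen1994HodgeAV, Thm. 6.12]
[cite: Schoen1998HodgeWeilAddendum] [cite: Abouzaid2021HMSWithoutCorrection] -/
theorem stub_lowRungs :
    ∀ (m : ℕ), 2 ≤ m → m ≤ 3 → ∀ (d : ℕ), 0 < d →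
      ∀ (P : WeilFamily.Polarization m d), P.IsVeryGeneral →
        ∀ (Z : TropicalTorusCycle (2 * m) m P.Q), WeilFamily.functional d Z ≠ 0 →
          (∀ ε : ℝ, 0 < ε → ∃ (L : Type) (_ : TopologicalSpace L) (_ : T2Space L) (_ : CompactSpace L)
              (_ : ChartedSpace (EuclideanSpace ℝ (Fin (2 * m))) L)
              (_ : IsManifold 𝓘(ℝ, EuclideanSpace ℝ (Fin (2 * m))) ((⊤ : ℕ∞) : WithTop ℕ∞) L)
              (f : L → CotangentTorus P.Q), IsGeometricLift P.Q Z ε f) →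
          ∀ (A : AbelianVariety ℂ) (φ : A ⟶ A), A.dim = 2 * m → IsSmoothProjective (2 * m) A.X →
            φ ≫ φ = -(d • 𝟙 A) →
            ∀ (e : ProjectiveEmbedding A.X) (a : complexBetti (projectiveSpace e.n ℂ) 2),
              IsRationalClass a → a ≠ 0 →
              IsHyperbolicWeilType A φ m ((d : ℂ) • complexBetti.map e.ι 2 a +
                complexBetti.map φ.hom.hom.hom 2 (complexBetti.map e.ι 2 a)) →
              ∃ c : complexBetti A.X (2 * m),
                c ∈ weilClassesOf A φ m d ∧ c ∈ algebraicClasses A.X m ∧ c ≠ 0 := by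
  sorry

/-- **Stub 3 — the first open rung `(m, d) = (4, 1)`: Gaussian hyperbolic abelian eightfolds.**
For a very general `P ∈ 𝓛_1⁺` in dimension `8` and an effective tropical `4`-cycle `Z` on `B_{P.Q}`
with non-zero `ℚ(i)`-Weil functional admitting graded geometric Lagrangian lifts at every scale:
every abelian eightfold `(A, φ)`, `φ ≫ φ = -1`, of hyperbolic Weil type carries a non-zero algebraic
class in `weilClassesOf A φ 4 1`. Nothing is known in print for Weil type in dimension `≥ 8`, for
any `K` (Markman 2025 §1.2): this is the BC5 rung of the route (typed literally as the `(4, 1)`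
instance of the bridge, `d = 1` kept as the cast natural number `1`).
[cite: Markman2025SecantWeil, §1.2] [cite: Zharkov2020TropicalWeil, §2]
[cite: Hicks2025Realizability, Def. 3.0.2 and Thm. 1.2] [cite: Abouzaid2017FamilyFloerFaithful] -/
theorem stub_firstOpenRung :
    ∀ (P : WeilFamily.Polarization 4 1), P.IsVeryGeneral →
      ∀ (Z : TropicalTorusCycle (2 * 4) 4 P.Q), WeilFamily.functional 1 Z ≠ 0 →
        (∀ ε : ℝ, 0 < ε → ∃ (L : Type) (_ : TopologicalSpace L) (_ : T2Space L) (_ : CompactSpace L)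
            (_ : ChartedSpace (EuclideanSpace ℝ (Fin (2 * 4))) L)
            (_ : IsManifold 𝓘(ℝ, EuclideanSpace ℝ (Fin (2 * 4))) ((⊤ : ℕ∞) : WithTop ℕ∞) L)
            (f : L → CotangentTorus P.Q), IsGeometricLift P.Q Z ε f) →
        ∀ (A : AbelianVariety ℂ) (φ : A ⟶ A), A.dim = 2 * 4 → IsSmoothProjective (2 * 4) A.X →
          φ ≫ φ = -((1 : ℕ) • 𝟙 A) →
          ∀ (e : ProjectiveEmbedding A.X) (a : complexBetti (projectiveSpace e.n ℂ) 2),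
            IsRationalClass a → a ≠ 0 →
            IsHyperbolicWeilType A φ 4 (((1 : ℕ) : ℂ) • complexBetti.map e.ι 2 a +
              complexBetti.map φ.hom.hom.hom 2 (complexBetti.map e.ι 2 a)) →
            ∃ c : complexBetti A.X (2 * 4),
              c ∈ weilClassesOf A φ 4 1 ∧ c ∈ algebraicClasses A.X 4 ∧ c ≠ 0 := by
  sorry

/-- **Stub 4 — the high rungs: `m ≥ 4`, `(m, d) ≠ (4, 1)` (the open range proper).** For such
`(m, d)`, a very general `P ∈ 𝓛_d⁺` and an effective tropical `m`-cycle `Z` on `B_{P.Q}` with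
non-zero `ℚ(√-d)`-Weil functional admitting graded geometric Lagrangian lifts at every scale: every
hyperbolic Weil-type abelian `2m`-fold `(A, φ)`, `φ ≫ φ = -d`, carries a non-zero algebraic class in
`weilClassesOf A φ m d` — the family-Floer mirror of `𝕏(B_{P.Q})` incarnates as the very general
member, the brane `(L_Z, b)` goes to a perfect complex with non-zero Weil component of its Chern
character, and the class spreads over the hyperbolic Weil locus.
[cite: Abouzaid2021HMSWithoutCorrection] [cite: Abouzaid2017FamilyFloerFaithful]
[cite: KontsevichSoibelman2010] [cite: Hicks2025Realizability, Thm. 1.2] [cite: Markman2025SecantWeil, §1.2] -/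
theorem stub_highRungs :
    ∀ (m : ℕ), 4 ≤ m → ∀ (d : ℕ), 0 < d → (m, d) ≠ (4, 1) →
      ∀ (P : WeilFamily.Polarization m d), P.IsVeryGeneral →
        ∀ (Z : TropicalTorusCycle (2 * m) m P.Q), WeilFamily.functional d Z ≠ 0 →
          (∀ ε : ℝ, 0 < ε → ∃ (L : Type) (_ : TopologicalSpace L) (_ : T2Space L) (_ : CompactSpace L)
              (_ : ChartedSpace (EuclideanSpace ℝ (Fin (2 * m))) L)
              (_ : IsManifold 𝓘(ℝ, EuclideanSpace ℝ (Fin (2 * m))) ((⊤ : ℕ∞) : WithTop ℕ∞) L)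
              (f : L → CotangentTorus P.Q), IsGeometricLift P.Q Z ε f) →
          ∀ (A : AbelianVariety ℂ) (φ : A ⟶ A), A.dim = 2 * m → IsSmoothProjective (2 * m) A.X →
            φ ≫ φ = -(d • 𝟙 A) →
            ∀ (e : ProjectiveEmbedding A.X) (a : complexBetti (projectiveSpace e.n ℂ) 2),
              IsRationalClass a → a ≠ 0 →
              IsHyperbolicWeilType A φ m ((d : ℂ) • complexBetti.map e.ι 2 a +
                complexBetti.map φ.hom.hom.hom 2 (complexBetti.map e.ι 2 a)) →
              ∃ c : complexBetti A.X (2 * m),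
                c ∈ weilClassesOf A φ m d ∧ c ∈ algebraicClasses A.X m ∧ c ≠ 0 := by
  sorry

/-! ## Name-keyed aliases of the four statements — the hypotheses of `MirrorRealization_of`
The skeleton audit (`#h21_check_skeleton`) admits a hypothesis of the skeleton theorem only if its
head constant is a registered obligation or is NAMED like a declared stub; `__Registered.stub_X` is
the statement of `stub_X` verbatim under the stub's short name (device of
`Cruxes/AlgebraicDensity/Lines/birth.lean` and `Cruxes/FormalCycleCriterion/Lines/birth.lean`).
`MirrorRealization_of_stubs` checks by definitional unfolding that each alias IS its stub's
statement. -/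
namespace __Registered

/-- Statement of `stub_veryGeneral_nonempty`, keyed by the registered stub name. -/
abbrev stub_veryGeneral_nonempty : Prop :=
  ∀ (n δ : ℕ), 1 ≤ δ → ∃ P : WeilFamily.Polarization n δ, P.IsVeryGeneral

/-- Statement of `stub_lowRungs`, keyed by the registered stub name. -/
abbrev stub_lowRungs : Prop :=
  ∀ (m : ℕ), 2 ≤ m → m ≤ 3 → ∀ (d : ℕ), 0 < d →
    ∀ (P : WeilFamily.Polarization m d), P.IsVeryGeneral →
      ∀ (Z : TropicalTorusCycle (2 * m) m P.Q), WeilFamily.functional d Z ≠ 0 →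
        (∀ ε : ℝ, 0 < ε → ∃ (L : Type) (_ : TopologicalSpace L) (_ : T2Space L) (_ : CompactSpace L)
            (_ : ChartedSpace (EuclideanSpace ℝ (Fin (2 * m))) L)
            (_ : IsManifold 𝓘(ℝ, EuclideanSpace ℝ (Fin (2 * m))) ((⊤ : ℕ∞) : WithTop ℕ∞) L)
            (f : L → CotangentTorus P.Q), IsGeometricLift P.Q Z ε f) →
        ∀ (A : AbelianVariety ℂ) (φ : A ⟶ A), A.dim = 2 * m → IsSmoothProjective (2 * m) A.X →
          φ ≫ φ = -(d • 𝟙 A) →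
          ∀ (e : ProjectiveEmbedding A.X) (a : complexBetti (projectiveSpace e.n ℂ) 2),
            IsRationalClass a → a ≠ 0 →
            IsHyperbolicWeilType A φ m ((d : ℂ) • complexBetti.map e.ι 2 a +
              complexBetti.map φ.hom.hom.hom 2 (complexBetti.map e.ι 2 a)) →
            ∃ c : complexBetti A.X (2 * m),
              c ∈ weilClassesOf A φ m d ∧ c ∈ algebraicClasses A.X m ∧ c ≠ 0

/-- Statement of `stub_firstOpenRung`, keyed by the registered stub name. -/
abbrev stub_firstOpenRung : Prop :=
  ∀ (P : WeilFamily.Polarization 4 1), P.IsVeryGeneral →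
    ∀ (Z : TropicalTorusCycle (2 * 4) 4 P.Q), WeilFamily.functional 1 Z ≠ 0 →
      (∀ ε : ℝ, 0 < ε → ∃ (L : Type) (_ : TopologicalSpace L) (_ : T2Space L) (_ : CompactSpace L)
          (_ : ChartedSpace (EuclideanSpace ℝ (Fin (2 * 4))) L)
          (_ : IsManifold 𝓘(ℝ, EuclideanSpace ℝ (Fin (2 * 4))) ((⊤ : ℕ∞) : WithTop ℕ∞) L)
          (f : L → CotangentTorus P.Q), IsGeometricLift P.Q Z ε f) →
      ∀ (A : AbelianVariety ℂ) (φ : A ⟶ A), A.dim = 2 * 4 → IsSmoothProjective (2 * 4) A.X →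
        φ ≫ φ = -((1 : ℕ) • 𝟙 A) →
        ∀ (e : ProjectiveEmbedding A.X) (a : complexBetti (projectiveSpace e.n ℂ) 2),
          IsRationalClass a → a ≠ 0 →
          IsHyperbolicWeilType A φ 4 (((1 : ℕ) : ℂ) • complexBetti.map e.ι 2 a +
            complexBetti.map φ.hom.hom.hom 2 (complexBetti.map e.ι 2 a)) →
          ∃ c : complexBetti A.X (2 * 4),
            c ∈ weilClassesOf A φ 4 1 ∧ c ∈ algebraicClasses A.X 4 ∧ c ≠ 0

/-- Statement of `stub_highRungs`, keyed by the registered stub name. -/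
abbrev stub_highRungs : Prop :=
  ∀ (m : ℕ), 4 ≤ m → ∀ (d : ℕ), 0 < d → (m, d) ≠ (4, 1) →
    ∀ (P : WeilFamily.Polarization m d), P.IsVeryGeneral →
      ∀ (Z : TropicalTorusCycle (2 * m) m P.Q), WeilFamily.functional d Z ≠ 0 →
        (∀ ε : ℝ, 0 < ε → ∃ (L : Type) (_ : TopologicalSpace L) (_ : T2Space L) (_ : CompactSpace L)
            (_ : ChartedSpace (EuclideanSpace ℝ (Fin (2 * m))) L)
            (_ : IsManifold 𝓘(ℝ, EuclideanSpace ℝ (Fin (2 * m))) ((⊤ : ℕ∞) : WithTop ℕ∞) L)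
            (f : L → CotangentTorus P.Q), IsGeometricLift P.Q Z ε f) →
        ∀ (A : AbelianVariety ℂ) (φ : A ⟶ A), A.dim = 2 * m → IsSmoothProjective (2 * m) A.X →
          φ ≫ φ = -(d • 𝟙 A) →
          ∀ (e : ProjectiveEmbedding A.X) (a : complexBetti (projectiveSpace e.n ℂ) 2),
            IsRationalClass a → a ≠ 0 →
            IsHyperbolicWeilType A φ m ((d : ℂ) • complexBetti.map e.ι 2 a +
              complexBetti.map φ.hom.hom.hom 2 (complexBetti.map e.ι 2 a)) →
            ∃ c : complexBetti A.X (2 * m),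
              c ∈ weilClassesOf A φ m d ∧ c ∈ algebraicClasses A.X m ∧ c ≠ 0

end __Registered

/-- **Composition (real proof) — THE SKELETON THEOREM.** Given tropical Weil supply `T`, geometric
Lagrangian lifting `A` and a hyperbolic Weil-type `(A, φ)` of type `(m, d)`, `m ≥ 2`, `d ≥ 1`: stub 1
gives a very general `P : Polarization m d`; `T` gives an effective tropical `m`-cycle `Z` on
`B_{P.Q}` with non-zero Weil functional; `A` lifts it at every scale; the rung owning `m`
(`m ≤ 3` / `(m, d) = (4, 1)` / the rest) returns the non-zero algebraic Weil class. Hypotheses =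
the four stub statements (name-keyed aliases); concludes the route decl `MirrorRealization`
BY NAME. -/
theorem MirrorRealization_of :
    __Registered.stub_veryGeneral_nonempty → __Registered.stub_lowRungs →
      __Registered.stub_firstOpenRung → __Registered.stub_highRungs →
        Summit.HodgeConjecture.HodgeConjecture.Theses.MirrorBraneLift.MirrorRealization := by
  intro hVG hLow hFour hHigh hT hA m hm d hd A φ hdim hX hφ e a ha ha0 hhyp
  -- a very general member of the tropical Weil family of type `(m, d)` (stub 1)
  obtain ⟨P, hP⟩ := hVG m d hd
  -- the tropical Weil cycle on it (T) and its geometric Lagrangian lifts at every scale (A)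
  obtain ⟨Z, hZ⟩ := hT m hm d hd P hP
  have hlift := fun (ε : ℝ) (hε : 0 < ε) => hA m hm d hd P Z ε hε
  -- the rung owning `m`
  by_cases h3 : m ≤ 3
  · exact hLow m hm h3 d hd P hP Z hZ hlift A φ hdim hX hφ e a ha ha0 hhyp
  · by_cases h41 : m = 4 ∧ d = 1
    · obtain ⟨rfl, rfl⟩ := h41
      exact hFour P hP Z hZ hlift A φ hdim hX hφ e a ha ha0 hhyp
    · exact hHigh m (by omega) d hd (fun h => h41 (Prod.mk_inj.mp h)) P hP Z hZ hlift A φ hdim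
        hX hφ e a ha ha0 hhyp

/-- **The crux, closed modulo exactly the four registered stubs** (sanity: the stubs compose, and
each alias is its stub's statement). -/
theorem MirrorRealization_of_stubs :
    Summit.HodgeConjecture.HodgeConjecture.Theses.MirrorBraneLift.MirrorRealization :=
  MirrorRealization_of stub_veryGeneral_nonempty stub_lowRungs stub_firstOpenRung stub_highRungs

end Summit.HodgeConjecture.HodgeConjecture.Cruxes.MirrorRealization.Birth
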